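import Literature.NumberTheory.EllipticCurves.CastellaGrossiLeeSkinner2022.AnticyclotomicControlTorsionFree
import HarnessLib

/-!
# Castella–Grossi–Skinner 2025, Prop. 3.4.2 (`prop:euler-char`) with Lemma 3.4.1 (`lem:coinv`) at the
# TRIVIAL character `α = 𝟙`: the two-line Euler characteristic — the Greenberg Selmer groups of `E` over
# the cyclotomic and the anticyclotomic `ℤ_p`-extension of `K` are both `Λ`-torsion and their
# characteristic power series have constant terms of the same `p`-adic valuation

HONEST FRAMING (cell `bsd-eis`, home `run/shared/lean/pub/bsd-eis/`; FULL-BSD rank-≤1 programme,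
row A3 = class X1 ∩ {`r_an = 0`}: crux `MazurMCOnX1RankZero`, item stmt-BirchSwinnertonDyer-19035,
line `interlude_with_torsion`, lead `bsd-line-x1-p2` g3). Typed ≠ proved ≠ endorsed; nothing here
proves BSD or any main conjecture. This file TYPES ONE published proposition of one refereed paper as a
named fact (`def … : Prop`, nothing asserted; D-0014/D-0026), in the EXISTING tree vocabulary of its
already-typed siblings (`CastellaGrossiLeeSkinner2022.thm511_anticyclotomicControl_of_torsionFree`,
`KellerYin2024.thm308_imc2_bdpValue_goodLattice_OPEN`: the Literature object `AcSelmer.XAc` and the shape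
`AcSelmer.XAc.HasCharValuationAt`), and proves only bookkeeping consequences.

## What and why

The crux line `interlude_with_torsion` (Cruxes/MazurMCOnX1RankZero/Lines/interlude_with_torsion.lean,
skeleton v2) runs Castella–Grossi–Skinner's §5 "Interlude" at the trivial twist at an ANOMALOUS good
lattice. Its stub (K1) `TwoLineEulerCharWithTorsion` — "`ord_p 𝓕_Gr⁻(0) = n ⟹ ord_p 𝓕_Gr⁺(0) = n`"
with NO torsion hypothesis — is consumed only at Keller–Yin's good lattice `E_g`, where `E_g(K)[p] = 0`
holds (tree theorem `torsion_baseChange_eq_zero_of_noUnramifiedLine`; a binder of the line currency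
`CycLineBDPValueGoodLattice`). Under `E(K)[p] = 0` the transport IS the printed Prop. 3.4.2 with
Lemma 3.4.1 at `α = 𝟙`, whose statements carry NO non-anomalous hypothesis (`φ|_{G_p} ≠ 𝟙, ω` occurs in
the final TeX only in the Introduction, l. 384/490/508, and in Thms. 7.1.1/7.2.3, l. 3279/3424 — lead's
desk check F1, 2026-08-28). This file gives that printed statement a NAME so that the line's K1 slot
becomes a PUBLISHED named fact (consumer: `Summit.…Theorems.InterludeWithTorsion.stub_plusLineValue_of_prop342`).

## Citation header

* F. Castella, G. Grossi, C. Skinner, *Mazur's main conjecture at Eisenstein primes*, Math. Ann.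
  **393** (2025) 2451–2506, doi:10.1007/s00208-025-03239-x = arXiv:2303.04373v2; bib key
  `CastellaGrossiSkinner2025`; REFEREED / PUBLISHED. Text read: the FINAL TeX `Mazur-paper_revised.tex`
  (sha16 8554fe0208c9a9e4, held at `run/shared/lean/b2b/bsd-rank1-residual/b2b-bsdres-lit-cgls/src/cgs25-final/`);
  all locators `l. NNNN`; printed numbering = final TeX (v1 numbers one section lower: Lemma 2.3.1,
  Prop. 2.3.2, see the table in `AnticyclotomicMainConjectures.lean`).
* Standing hypotheses of §3 (l. 1104): "we let `E/ℚ` be an elliptic curve of conductor `N`, `p` an odd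
  prime of good ordinary reduction for `E`, and `K` an imaginary quadratic field satisfying (Heeg) and
  (spl)"; §3.1 (l. 1110–1113): "Let `Σ` be a finite set of places of `ℚ` containing the prime `p`, `∞`,
  and the prime factors of `N`. We assume throughout that all finite primes in `Σ` split in `K`."
  (Heeg) = "every prime `ℓ | N` splits in `K`" (l. 897–899); (spl) = "`(p) = v v̄` splits in `K`, with
  `v` the prime above `p` induced by `ι_p`" (l. 698–702); `Γ_K^+` (resp. `Γ_K^-`) "is identified with
  the Galois group of the cyclotomic `ℤ_p`-extension `K_∞⁺/K` (resp. the anticyclotomic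
  `ℤ_p`-extension of `K_∞⁻/K`)" (l. 706); `𝔛_Gr(E/K_∞^±) = H¹_{𝓕_{rel,str}}(K, T_pE ⊗ (Λ_K^±)^∨)^∨` —
  relaxed at `v`, strict at `v̄`, trivial at `w ∈ Σ`, `w ∤ p` (Def. 3.1.1 and (3.1), l. 1130–1165).
* **Lemma 3.4.1** (`lem:coinv`, l. 1469–1485), verbatim: "Assume `E(K)[p]=0` and `α : Γ_K^- → R^×` is
  a crystalline character such that: (a) `corank_R H¹_{𝓕_BK}(K, W_{α⁻¹}) = 1`, (b) The restriction map
  `H¹_{𝓕_ord}(K, W_{α⁻¹}) →^{loc_v} H¹_ord(K_v, W_{α⁻¹})` is nonzero. Then the following hold: (i)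
  `H¹_{𝓕_Gr}(K, W_α)` is finite, and `H¹_{𝓕_Gr}(K, T_α) = 0`. (ii) `H¹(G_{K,Σ}, M_α^±)_{Γ_K^±} = 0`.
  (iii) For any `S' ⊂ Σ` consisting of primes away from `p`, `H¹_{𝓕_Gr^{S'}}(K, M_α^±)_{Γ_K^±} = 0`."
* (l. 1506): "As standard, we shall often identify `Λ_K^±` with the one variable power series ring
  `ℤ_p[[T^±]]` via `γ^± = 1 + T^±` upon the choice of a topological generator `γ^± ∈ Λ_K^±`."
* **Proposition 3.4.2** (`prop:euler-char`, l. 1512–1524), verbatim: "Suppose `E(K)[p]=0` and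
  `α : Γ_K^- → R^×` is such that the conditions in Lemma 3.4.1 hold. Then the Selmer groups
  `𝔛_Gr^{S'}(E(α)/K_∞^+)` and `𝔛^{S'}_Gr(E(α)/K_∞^-)` are torsion over `Λ_K^+` and `Λ_K^-`,
  respectively, where `S' ⊂ Σ` is any subset consisting of primes away from `p`. Furthermore, we have
  the equality up to a `p`-adic unit: `𝓕_Gr^{S'}(E(α)/K_∞^+)(0) ∼_p 𝓕_Gr^{S'}(E(α)/K_∞^-)(0)`, where
  `𝓕_Gr^{S'}(E(α)/K_∞^±) ∈ Λ^±_{K,R}` is any characteristic power series for `𝔛_Gr^{S'}(E(α)/K_∞^±)`."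
* **At `α = 𝟙`** (§5, l. 2076–2085 and l. 2108), verbatim: "In this section we give a proof of Theorem A
  under the following two additional hypotheses: (a) `corank_{ℤ_p} Sel_{p^∞}(E/K) = 1`. (b) The
  restriction map `Sel_{p^∞}(E/K) →^{loc_v} E(K_v) ⊗ ℚ_p/ℤ_p` is nonzero." … "Conditions (a) and (b)
  above correspond to conditions (a) and (b) in Lemma 3.4.1 with `α = 1`" — the authors' own reading
  of Lemma 3.4.1 (a), (b) at the trivial character (`R = ℤ_p`, `T_α = T_pE`, `W_α = E[p^∞]`; the
  trivial character is crystalline and `≡ 1 (mod ϖ^m)` for every `m`).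

## Hypotheses, enumerated (word for word → tree predicate)

1. "`E/ℚ` … of conductor `N`" — `W : WeierstrassCurve ℚ`, `[W.IsElliptic]`, `[W.IsGloballyMinimal]`
   (a globally minimal model of `E`; `N = W.conductorNorm ℤ`), as in every sibling.
2. "`p` an odd prime of good ordinary reduction" — `2 < p`, `GoodOrd W p` (as in `thm511_…`).
3. "`K` imaginary quadratic … (Heeg) and (spl)", "all finite primes in `Σ` split in `K`" (with
   `Σ = {p, ∞} ∪ {ℓ ∣ N}`) — `IsImaginaryQuadratic K`, `SatisfiesHeegnerHypothesis (W.conductorNorm ℤ) K`,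
   `SatisfiesHeegnerHypothesis p K` (the atoms of `thm511_…` / `thm308_…`). NO (disc) here (it is not
   a hypothesis of §3).
4. "`E(K)[p] = 0`" — `∀ Q : (W.baseChange K).toAffine.Point, p • Q = 0 → Q = 0` (verbatim the binder of
   `thm511_anticyclotomicControl_of_torsionFree`).
5. (a) at `α = 𝟙`: "`corank_{ℤ_p} Sel_{p^∞}(E/K) = 1`" — `(W.baseChange K).selmerCorank p = 1`.
6. (b) at `α = 𝟙`: "`loc_v : Sel_{p^∞}(E/K) → E(K_v) ⊗ ℚ_p/ℤ_p` is nonzero" — transcribed as the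
   SPECIAL CASE "`E(K)` has a point of infinite order" (`∃ P, ¬ IsOfFinAddOrder P`), which IMPLIES (b)
   (the Kummer image of `P` lies in `Sel_{p^∞}(E/K)` and is non-zero in `E(K_v) ⊗ ℚ_p/ℤ_p ≅ ℚ_p/ℤ_p ⊕ 0`
   since `P` has infinite order in `E(K_v) ≅ ℤ_p ⊕` finite) — EXACTLY the transcription of the same
   hypothesis in `CastellaGrossiSkinner2025.thmA_charIdeal_eq_padicLFunction_of_selmerCorankOne`
   (`MazurMainConjectureRankOne.lean`, item 6). WEAKER than print, never stronger.
   `-- TODO(general form): (b) verbatim needs the restriction map on Sel_{p^∞}(E/K), not in the tree.`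
7. "`(p) = v v̄`, `v` induced by `ι_p`" — `v vbar : HeightOneSpectrum (𝓞 K)`, `↑p ∈ v.asIdeal`,
   `↑p ∈ vbar.asIdeal`, `vbar ≠ v` (under (spl) these are the two primes above `p`; the printed statement
   for the conjugate embedding is the same statement with `v`, `v̄` exchanged, so the labelling is free).
8. "`K_∞^+` cyclotomic, `K_∞^-` anticyclotomic, `γ^±` a topological generator, `Λ_K^± = ℤ_p[[T^±]]` via
   `γ^± = 1 + T^±`" — `κp κm : ZpExtension K p`, `κp.IsCyclotomic`, `κm.IsAnticyclotomic`,
   `γp γm : absoluteGaloisGroup K`, `[Fact (κp.IsTopGenerator γp)]`, `[Fact (κm.IsTopGenerator γm)]`; the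
   `Λ = ℤ_p⟦T⟧ = IwasawaAlgebra p`-module `AcSelmer.XAc (W.baseChange K) p κ vbar ∅ γ` IS
   `𝔛_Gr(E/K_∞^±)` (strict at `v̄`, relaxed at `v`, trivial away from `p`; `K_∞`-formulation = the
   `Λ`-adic one by Shapiro's lemma — the identification already made by both siblings), with `T` acting
   as `γ − 1` (`AcSelmer.XAc.X_smul_apply`). `S' = ∅`.
9. Conclusion — "torsion over `Λ_K^+` and `Λ_K^-`" ∧ "`𝓕⁺(0) ∼_p 𝓕⁻(0)` for ANY characteristic power
   series": `Module.IsTorsion` for both modules, and, in the generator-independent packaged currency of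
   the siblings (`AcSelmer.XAc.HasCharValuationAt … n` = "torsion, `char = (f)`, `f(0) ≠ 0`,
   `ord_p f(0) = n`"; `HasCharValuationAt.unique`), `∀ n, HasCharValuationAt⁻ n ↔ HasCharValuationAt⁺ n`
   (two elements of `ℤ_p` equal up to a unit are both zero or both non-zero of the same valuation) —
   implied by print, never stronger.

D-0026: exactly ONE new `def … : Prop` + proved consumers; no `_holds` is to be expected (Selmer groups
over `ℤ_p`-extensions). Printed proof inputs (for the referee's DAG, l. 1487–1503, 1526–1576): JSW 2017
Prop. 3.2.1 (finiteness of `H¹_{𝓕_Gr}(K,W)`), Poitou–Tate, Mazur control, Greenberg LNM 1716 Lemma 4.2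
(`Γ`-Euler characteristic), JSW Prop. 3.3.7 (`# ker(r^±) = #H⁰(K_v,W)² · ∏ c_w^{(p)}`, the same for both
signs) — all refereed; NO use of Thm. 4.1.1 / [BSTW] (the preprint node of the paper is not upstream of
Prop. 3.4.2).

## Contents
* `prop342_twoLineEulerChar_trivialChar` — the named fact (ONE new `def … : Prop`; statement only, no
  consumers here: the K1-shaped consumer `ord_p 𝓕⁻(0) = n ⟹ ord_p 𝓕⁺(0) = n` is the projection
  `(h … ).2.2 n |>.mp`, used unfolded by `Summit.…Theorems.InterludeWithTorsion.stub_plusLineValue_of_prop342`).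

## References
* [CastellaGrossiSkinner2025] Math. Ann. 393 (2025) = arXiv:2303.04373v2: Lemma 3.4.1 (l. 1469–1485)
  and proof (l. 1487–1503), Prop. 3.4.2 (l. 1512–1524) and proof (l. 1526–1576), §3 standing (l. 1104,
  1110–1113), §2 (l. 697–716), §5 (l. 2076–2085, 2108, 2131–2135).
* [JetchevSkinnerWan2017] Camb. J. Math. 5 (2017): Prop. 3.2.1, Prop. 3.3.7 (inputs of the printed proof).
* [GreenbergLNM1716] Lemma 4.2 (input of the printed proof).
* Siblings: `CastellaGrossiLeeSkinner2022/AnticyclotomicControlTorsionFree.lean` (A170-as-proved),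
  `KellerYin2024/AnomalousAnticyclotomicMainConjecture.lean`, `CastellaGrossiSkinner2025/MazurMainConjectureRankOne.lean`.
-/


noncomputable section

open scoped Classical

open WeierstrassCurve NumberField IsDedekindDomain Field Literature.NumberTheory.EllipticCurves
  Literature.NumberTheory.EllipticCurves.Rank1Residual
  Literature.NumberTheory.EllipticCurves.Castella2018

namespace Literature.NumberTheory.EllipticCurves.CastellaGrossiSkinner2025

/-- **Castella–Grossi–Skinner, Math. Ann. 393 (2025), Proposition 3.4.2 (`prop:euler-char`) with
Lemma 3.4.1 (`lem:coinv`), at the trivial character `α = 𝟙` and `S' = ∅`.** Verbatim (final TeX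
l. 1512–1524): "Suppose `E(K)[p]=0` and `α : Γ_K^- → R^×` is such that the conditions in Lemma 3.4.1
hold. Then the Selmer groups `𝔛_Gr^{S'}(E(α)/K_∞^+)` and `𝔛^{S'}_Gr(E(α)/K_∞^-)` are torsion over `Λ_K^+`
and `Λ_K^-`, respectively … Furthermore, we have the equality up to a `p`-adic unit:
`𝓕_Gr^{S'}(E(α)/K_∞^+)(0) ∼_p 𝓕_Gr^{S'}(E(α)/K_∞^-)(0)`, where `𝓕_Gr^{S'}(E(α)/K_∞^±) ∈ Λ^±_{K,R}` is any
characteristic power series for `𝔛_Gr^{S'}(E(α)/K_∞^±)`"; the conditions of Lemma 3.4.1 at `α = 1` are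
(§5, l. 2076–2085, 2108: "Conditions (a) and (b) above correspond to conditions (a) and (b) in
Lemma 3.4.1 with `α = 1`") (a) `corank_{ℤ_p} Sel_{p^∞}(E/K) = 1`, (b) `loc_v : Sel_{p^∞}(E/K) →
E(K_v) ⊗ ℚ_p/ℤ_p` nonzero — (b) transcribed as the special case "a point of infinite order" (module
docstring item 6). Standing (§3, l. 1104, 1110–1113): `p` odd, good ordinary; `K` imaginary quadratic
with (Heeg), (spl). Dictionary (module docstring items 1–9): `𝔛_Gr(E/K_∞^±) = AcSelmer.XAc (W.baseChange K)
p κ^± vbar ∅ γ^±` (strict at `v̄`, relaxed at `v`), `κ⁺` cyclotomic, `κ⁻` anticyclotomic, `γ^±`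
topological generators (`T^± = γ^± − 1`); conclusion: both modules `Λ`-torsion and
`∀ n, ord_p 𝓕⁻(0) = n ⟺ ord_p 𝓕⁺(0) = n` in the packaged currency `AcSelmer.XAc.HasCharValuationAt`.
NEVER cite this `Prop` as a theorem of the tree; take it as an explicit hypothesis (refereed print).
[cite: CastellaGrossiSkinner2025, Prop. 3.4.2 and Lemma 3.4.1 (§3.4.1; arXiv:2303.04373v2 final TeX l. 1469–1485, 1512–1524), with §3 standing hypotheses (l. 1104, 1110–1113) and §5 (l. 2076–2085, 2108) for α = 1] -/
def prop342_twoLineEulerChar_trivialChar : Prop :=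
  ∀ (W : WeierstrassCurve ℚ) [W.IsElliptic] [W.IsGloballyMinimal] (p : ℕ) [Fact p.Prime],
    2 < p → GoodOrd W p →
    ∀ (K : Type) [Field K] [NumberField K], IsImaginaryQuadratic K →
      SatisfiesHeegnerHypothesis (W.conductorNorm ℤ) K → SatisfiesHeegnerHypothesis p K →
      (∀ Q : (W.baseChange K).toAffine.Point, p • Q = 0 → Q = 0) →
      (W.baseChange K).selmerCorank p = 1 →
      (∃ P : (W.baseChange K).toAffine.Point, ¬ IsOfFinAddOrder P) →
    ∀ (v vbar : HeightOneSpectrum (𝓞 K)),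
      ((p : ℕ) : 𝓞 K) ∈ v.asIdeal → ((p : ℕ) : 𝓞 K) ∈ vbar.asIdeal → vbar ≠ v →
    ∀ (κp κm : ZpExtension K p), κp.IsCyclotomic → κm.IsAnticyclotomic →
    ∀ (γp γm : absoluteGaloisGroup K) [Fact (κp.IsTopGenerator γp)] [Fact (κm.IsTopGenerator γm)],
      Module.IsTorsion (IwasawaAlgebra p) (AcSelmer.XAc (W.baseChange K) p κp vbar ∅ γp) ∧
      Module.IsTorsion (IwasawaAlgebra p) (AcSelmer.XAc (W.baseChange K) p κm vbar ∅ γm) ∧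
      ∀ n : ℕ, AcSelmer.XAc.HasCharValuationAt (W.baseChange K) p κm vbar ∅ γm n ↔
        AcSelmer.XAc.HasCharValuationAt (W.baseChange K) p κp vbar ∅ γp n

end Literature.NumberTheory.EllipticCurves.CastellaGrossiSkinner2025

end
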